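import Summits.BirchSwinnertonDyer.BirchSwinnertonDyer.Theorems.EisensteinPrimesUnrSelmerLocSurjAdapter
import Summits.BirchSwinnertonDyer.BirchSwinnertonDyer.Theorems.EisensteinPrimesCharLocalTorsionBound
import Summits.BirchSwinnertonDyer.BirchSwinnertonDyer.Theorems.EisensteinPrimesSelmerAcQuotientCorankOfLoc
import Summits.BirchSwinnertonDyer.BirchSwinnertonDyer.Theorems.AlignedTransportAtTwoMainConjectureOfRankZeroBSDAtTwoFineRoadCokerAtTwo
import Summits.BirchSwinnertonDyer.Rank1Residual.X11b.AnticyclotomicSelmer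
import HarnessLib

/-!
# The RELAXATION COUNT for Castella's anticyclotomic Selmer groups of an elliptic curve:
# `corank_{ℤ_p}(Sel_𝔭^{Sf}/Sel_𝔭^∅)(K_∞, E[p^∞]) = Σ_{w∈Sf} [Γ:Γ_w] · corank_{ℤ_p} H¹(K_{∞,w}, E[p^∞])`, GRANTED the `K_∞`-side
# global-to-local surjectivity at the places above `Sf`

Route `CumulativeHeegnerLeopoldt`, crux K2-odd stmt-23970, line `birth`, stub ALG-≥(i) `stub_curveRelaxationCorankEq` (lead
`bsd-line-chl-p1` g10; helper, `--supports stmt-BirchSwinnertonDyer-23970`). Curve-side twin of cell `bsd-eis`'s character bookkeeping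
(`UnrSelmerNaturalLocalization`, `UnrSelmerLocSurjAdapter`, `UnrSelmerQuotientCorankGeOfSurjective`, `CharLocalTorsionBound`) for
`M = E[p^∞]` and Castella's `selmerAc` (locally TRIVIAL off `S`, strict at `𝔭`), whose off-`S` condition is `awayKer` itself:
§1 kernel of the canonical localisation `Sel_𝔭^{Sf} → ∏_{w∈Sf} ∏_{i<[Γ:Γ_w]} H¹(ker κ ⊓ D_w, E[p^∞])` = `Sel_𝔭^∅`
(`forall_conjH1_mem_awayKer_of_forall_lt`, `mem_selmerAc_empty_iff_forall_resOfLe_conjH1_eq_zero`, `ker_pi_resOfLe_conjH1_selmerAc_eq`);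
§2 `H¹(ker κ ⊓ D_w, E[p^∞])[p]` FINITE at `w ∤ p` finitely decomposed (Kummer `finite_torsionBy_discreteH1_of_finite` + the tree's
`NonsplitTower.finite_subgroupH1_and_natCard_le` on `E[p]`); §3 the count from a surjection / from the canonical map / from the
`∃`-form with arbitrary representatives and the exponent currency `κ(D_w) = p^{a_w} ℤ_p` (the output shape of
`AcTwistDeformation.exists_mem_unramifiedOutside_forall_resOfLe_conjH1_eq_of_SUR`). Tool theorems (no definition, no named fact,
no `sorry`); the surjectivity is a HYPOTHESIS; closes nothing by itself. BSD is not proved by any of this.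
References: [GreenbergVatsal2000] §2 Cor. (2.3), Prop. (2.4); [PollackWeston2011] App. A Prop. A.2; [KellerYin2024] Prop. 1.2.5,
Rem. 1.4.2 (arXiv:2402.12781v2); [Castella2018] Def. 2.2; [GreenbergLNM1716] §3 Lemma 3.3; [SerreGaloisCohomology1997] I §2.2.
-/

set_option autoImplicit false
-- `…BirchSwinnertonDyer.BirchSwinnertonDyer.Theorems…` is the problem's mandated namespace (D-0017).
set_option linter.dupNamespace false

noncomputable section

open scoped Classical AddSubgroup

open CategoryTheory Function NumberField IsDedekindDomain Field Multiplicative WeierstrassCurve ValuativeRel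
  Literature.NumberTheory.EllipticCurves Literature.NumberTheory.EllipticCurves.GreenbergSelmer
  Literature.NumberTheory.GaloisRepresentations Literature.NumberTheory.EllipticCurves.KellerYin2024
  Literature.NumberTheory.GaloisRepresentations.IsNonarchimedeanLocalField
  IsDedekindDomain.HeightOneSpectrum
  Summit.BirchSwinnertonDyer.Rank1Residual Summit.BirchSwinnertonDyer.Rank1Residual.Iwasawa
  Summit.BirchSwinnertonDyer.BirchSwinnertonDyer.Theorems
  Summit.BirchSwinnertonDyer.BirchSwinnertonDyer.Theorems.DecompositionCountNumPlaces
  Summit.BirchSwinnertonDyer.BirchSwinnertonDyer.Theorems.UnrSelmerNaturalLocalization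
  Summit.BirchSwinnertonDyer.BirchSwinnertonDyer.Theorems.UnrSelmerLocSurjAdapter
  Summit.BirchSwinnertonDyer.BirchSwinnertonDyer.Theorems.UnrSelmerQuotientCorankGeOfSurjective

namespace Summit.BirchSwinnertonDyer.BirchSwinnertonDyer.Theorems.CurveRelaxationCount

variable {K : Type} [Field K] [NumberField K] {p : ℕ} [hp : Fact p.Prime] (κ : ZpExtension K p)

/-! ## §1 The kernel of the canonical localisation on `Sel_𝔭^{Sf}(K_∞, E[p^∞])` is `Sel_𝔭^∅` -/

section Kernel

variable {M : Type} [AddCommGroup M] [DistribMulAction (absoluteGaloisGroup K) M] [TopologicalSpace M]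
  [DiscreteTopology M]

/-- **Local triviality at the `N` representatives ⇒ at every conjugate.** If `Γ_K = ker κ · D_w · {γ^n : n < N}` (the
shape of `hrep_numPlacesAbove` at a finitely decomposed `w`) and `conj_{γ^n} c ∈ awayKer w` for all `n < N`, then
`conj_σ c ∈ awayKer w` for every `σ` (`conj_h = id` for `h ∈ ker κ`; `conj_δ` preserves `awayKer w` for `δ ∈ D_w`).
The `awayKer` twin of the tree's `Iwasawa.forall_conjH1_mem_unramifiedKer_of_forall_lt`.
[cite: GreenbergVatsal2000, §2 p. 17] [cite: Greenberg1989, §1 p. 98] -/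
theorem forall_conjH1_mem_awayKer_of_forall_lt {w : HeightOneSpectrum (𝓞 K)} {γ : absoluteGaloisGroup K} {N : ℕ}
    (hrep : ∀ σ : absoluteGaloisGroup K, ∃ n < N, ∃ δ ∈ decomp (K := K) w, ∃ h ∈ κ.kerSubgroup,
      σ = h * (δ * γ ^ n))
    {c : Literature.NumberTheory.EllipticCurves.subgroupH1 κ.kerSubgroup M}
    (hc : ∀ n < N, conjH1 κ.kerSubgroup M (γ ^ n) c ∈ awayKer κ.kerSubgroup M w)
    (σ : absoluteGaloisGroup K) : conjH1 κ.kerSubgroup M σ c ∈ awayKer κ.kerSubgroup M w := by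
  haveI : κ.kerSubgroup.Normal := by rw [ZpExtension.kerSubgroup]; infer_instance
  obtain ⟨n, hn, δ, hδ, h, hh, rfl⟩ := hrep σ
  rw [conjH1_mul_of_mem_left κ.kerSubgroup M hh, conjH1_mul_holds κ.kerSubgroup M δ (γ ^ n),
    AddMonoidHom.comp_apply]
  exact AlignedTransportAtTwoFineRoad.CokerAtTwo.conjH1_mem_awayKer_of_mem_decomp κ.kerSubgroup M hδ (hc n hn)

end Kernel

section Curve

variable (W : WeierstrassCurve K) (𝔭 : HeightOneSpectrum (𝓞 K))
  (Sf : Finset (HeightOneSpectrum (𝓞 K)))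

/-- **For `c ∈ Sel_𝔭^{Sf}(K_∞, E[p^∞])`: `c ∈ Sel_𝔭^∅ ⟺ res_{ker κ ⊓ D_w}(conj_{γ^i} c) = 0` for all `w ∈ Sf`, `i < N w`**
(`N w = numPlacesAbove κ w`; `κ` any `ℤ_p`-extension with topological generator `γ`; `Sf` a finite set of places `w ∤ p`
finitely decomposed in `K_∞`). Castella's off-`S` condition IS local triviality at every conjugate (`awayKer`), so (⇒) is the
definition at the representatives and (⇐) is `forall_conjH1_mem_awayKer_of_forall_lt`.
[cite: Castella2018, Def. 2.2 (arXiv:1704.06608 p. 5)] [cite: GreenbergVatsal2000, §2 pp. 17, 20–21] -/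
theorem mem_selmerAc_empty_iff_forall_resOfLe_conjH1_eq_zero {γ : absoluteGaloisGroup K}
    (hγ : κ.IsTopGenerator γ) (hSfp : ∀ w ∈ Sf, ((p : ℕ) : 𝓞 K) ∉ w.asIdeal)
    (hSfdec : ∀ w ∈ Sf, ∃ δ ∈ decomp (K := K) w, κ δ ≠ 1)
    (N : HeightOneSpectrum (𝓞 K) → ℕ) (hN : ∀ w ∈ Sf, N w = numPlacesAbove κ w)
    {c : Literature.NumberTheory.EllipticCurves.subgroupH1 κ.kerSubgroup (W.geomPrimaryTorsion p)}
    (hc : c ∈ X11b.AcSelmer.selmerAc W p κ 𝔭 (↑Sf : Set (HeightOneSpectrum (𝓞 K)))) :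
    c ∈ X11b.AcSelmer.selmerAc W p κ 𝔭 (∅ : Set (HeightOneSpectrum (𝓞 K))) ↔
      ∀ w ∈ Sf, ∀ i < N w,
        resOfLe (W.geomPrimaryTorsion p) (inf_le_left : κ.kerSubgroup ⊓ decomp (K := K) w ≤ κ.kerSubgroup)
          (conjH1 κ.kerSubgroup (W.geomPrimaryTorsion p) (γ ^ i) c) = 0 := by
  rw [X11b.AcSelmer.selmerAc, X11b.AcSelmer.mem_selmerOver_iff] at hc ⊢
  constructor
  · intro h w hw i _
    exact h.1 w (hSfp w hw) (Set.notMem_empty w) (γ ^ i)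
  · intro h
    refine ⟨fun v hpv _ σ ↦ ?_, hc.2.1, hc.2.2⟩
    by_cases hv : v ∈ Sf
    · exact forall_conjH1_mem_awayKer_of_forall_lt κ (hrep_numPlacesAbove κ hγ Sf hSfdec v hv)
        (fun i hi ↦ h v hv i (by rw [hN v hv]; exact hi)) σ
    · exact hc.1 v hpv (fun h' ↦ hv (Finset.mem_coe.mp h')) σ

/-- **The kernel of the canonical localisation `Sel_𝔭^{Sf}(K_∞, E[p^∞]) → ∏_{w∈Sf} ∏_{i<[Γ:Γ_w]} H¹(ker κ ⊓ D_w, E[p^∞])`,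
`c ↦ (res_{ker κ ⊓ D_w} conj_{γ^i} c)_{w,i}`, IS `Sel_𝔭^∅`** (bundled form). [cite: GreenbergVatsal2000, §2 pp. 20–21]
[cite: KellerYin2024, Prop. 1.2.5 (eq:Gr to imp) (arXiv:2402.12781v2 TeX L789–800)] -/
theorem ker_pi_resOfLe_conjH1_selmerAc_eq {γ : absoluteGaloisGroup K}
    (hγ : κ.IsTopGenerator γ) (hSfp : ∀ w ∈ Sf, ((p : ℕ) : 𝓞 K) ∉ w.asIdeal)
    (hSfdec : ∀ w ∈ Sf, ∃ δ ∈ decomp (K := K) w, κ δ ≠ 1)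
    (N : HeightOneSpectrum (𝓞 K) → ℕ) (hN : ∀ w ∈ Sf, N w = numPlacesAbove κ w) :
    ((AddMonoidHom.pi fun w : ↥Sf ↦ AddMonoidHom.pi fun i : Fin (N (w : HeightOneSpectrum (𝓞 K))) ↦
        (resOfLe (W.geomPrimaryTorsion p) (inf_le_left :
            κ.kerSubgroup ⊓ decomp (K := K) (w : HeightOneSpectrum (𝓞 K)) ≤ κ.kerSubgroup)).comp
          (conjH1 κ.kerSubgroup (W.geomPrimaryTorsion p) (γ ^ (i : ℕ)))).comp
      (X11b.AcSelmer.selmerAc W p κ 𝔭 (↑Sf : Set (HeightOneSpectrum (𝓞 K)))).subtype).ker =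
      (X11b.AcSelmer.selmerAc W p κ 𝔭 (∅ : Set (HeightOneSpectrum (𝓞 K)))).addSubgroupOf
        (X11b.AcSelmer.selmerAc W p κ 𝔭 (↑Sf : Set (HeightOneSpectrum (𝓞 K)))) := by
  ext c
  rw [AddMonoidHom.mem_ker, AddSubgroup.mem_addSubgroupOf,
    mem_selmerAc_empty_iff_forall_resOfLe_conjH1_eq_zero κ W 𝔭 Sf hγ hSfp hSfdec N hN c.2]
  constructor
  · intro h w hw i hi
    have h' := congrFun (congrFun h ⟨w, hw⟩) ⟨i, hi⟩
    exact h'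
  · intro h
    funext w i
    exact h w w.2 i i.2

end Curve

/-! ## §2 `H¹(ker κ ⊓ D_w, E[p^∞])[p]` is finite at `w ∤ p` finitely decomposed -/

section KummerFinite

variable {Γ : Type} [Group Γ] [TopologicalSpace Γ] [IsTopologicalGroup Γ]
  {M : Type} [AddCommGroup M] [DistribMulAction Γ M] [TopologicalSpace M] [DiscreteTopology M]

omit [NumberField K] hp in
/-- **Kummer: the `n`-torsion of `H¹(Γ, M)` is the image of `H¹(Γ, M[n])`** (discrete `Γ`-module `M` with continuous orbit
maps on which multiplication by `n` is onto), hence FINITE when `H¹(Γ, M[n])` is — the cohomology sequence of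
`0 → M[n] → M →(n) M → 0` at `H¹(Γ, M) →(n) H¹(Γ, M)` (tree: `IsSES.exists_map_one_eq_of_map_one_eq_zero`). The
surjectivity half of the tree's `KummerTorsionH1.natCard_nsmul_eq_zero_discreteH1_eq`, with no hypothesis on the invariants.
[cite: SerreGaloisCohomology1997, I §2.2] [cite: MilneADT2006, I §2 Lemma 2.9] -/
theorem finite_torsionBy_discreteH1_of_finite (n : ℕ) (hcont : ∀ m : M, Continuous fun g : Γ ↦ g • m)
    (hdiv : ∀ m : M, ∃ m' : M, n • m' = m) [Finite (discreteH1 Γ ↥(M[(n : ℤ)]))] :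
    Finite ((discreteH1 Γ M)[(n : ℤ)]) := by
  let ρ : ContinuousRep Γ ℤ M :=
    { toRepresentation := (discreteContRep Γ M).toRepresentation
      continuous_smul := continuous_prod_of_discrete_right.mpr hcont }
  have hcont₁ : ∀ b : ↥(M[(n : ℤ)]), Continuous fun g : Γ ↦ g • b := fun b ↦
    continuous_induced_rng.2 (by
      change Continuous fun g : Γ ↦ ((g • b : ↥(M[(n : ℤ)])) : M)
      simp only [AddSubgroup.torsionBy.coe_smul]
      exact hcont (b : M))
  let ρ₁ : ContinuousRep Γ ℤ ↥(M[(n : ℤ)]) :=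
    { toRepresentation := (discreteContRep Γ ↥(M[(n : ℤ)])).toRepresentation
      continuous_smul := continuous_prod_of_discrete_right.mpr hcont₁ }
  let f : ρ₁.toTopRep ⟶ ρ.toTopRep :=
    TopRep.ofHom ⟨⟨(M[(n : ℤ)]).subtype.toIntLinearMap, continuous_of_discreteTopology⟩,
      fun σ ↦ by ext m; rfl⟩
  let g : ρ.toTopRep ⟶ ρ.toTopRep :=
    TopRep.ofHom
      { toLinearMap :=
          { toFun := fun a ↦ n • a
            map_add' := fun a b ↦ nsmul_add a b n
            map_smul' := fun c a ↦ by
              change n • (c • a) = c • (n • a)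
              exact smul_comm n c a }
        cont := continuous_of_discreteTopology
        isIntertwining' := fun σ ↦ by
          refine ContinuousLinearMap.ext fun a ↦ ?_
          change n • ρ.toTopRep.ρ σ a = ρ σ (n • a)
          rw [ContinuousRep.toTopRep_ρ_apply, map_nsmul] }
  have hg : ∀ a : M, g.hom a = n • a := fun _ ↦ rfl
  have hSES : IsSES f g :=
    { comp_eq_zero := by
        ext b
        change n • ((b : ↥(M[(n : ℤ)])) : M) = 0
        exact AddSubgroup.torsionBy.nsmul_iff.mp b.2
      injective := Subtype.val_injective
      exact_mid := fun y hy ↦ ⟨⟨y, AddSubgroup.torsionBy.nsmul_iff.mpr hy⟩, rfl⟩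
      surjective := fun a ↦ hdiv a }
  -- every `n`-torsion class comes from `H¹(Γ, M[n])`
  have hsurj : ∀ x : continuousCohomology 1 ρ.toTopRep, n • x = 0 →
      ∃ y : continuousCohomology 1 ρ₁.toTopRep, cohomologyMap f 1 y = x := by
    intro x hx
    refine hSES.exists_map_one_eq_of_map_one_eq_zero x ?_
    rw [cohomologyMap_one_eq_nsmul ρ g n hg]
    exact hx
  -- the image of `H¹(f)` is `n`-torsion
  have htor : ∀ y : continuousCohomology 1 ρ₁.toTopRep, n • cohomologyMap f 1 y = 0 := by
    intro y
    obtain ⟨c, rfl⟩ := oneCocycleClass_surjective _ y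
    have hc : (n : ℤ) • c = 0 := by
      refine Subtype.ext (ContinuousMap.ext fun σ ↦ Subtype.ext ?_)
      change ((((n : ℤ) • c.1 σ) : ↥(M[(n : ℤ)])) : M) = 0
      rw [natCast_zsmul, AddSubmonoidClass.coe_nsmul]
      exact AddSubgroup.torsionBy.nsmul_iff.mp (c.1 σ).2
    rw [← map_nsmul, ← Nat.cast_smul_eq_nsmul ℤ, ← oneCocycleClass_smul, hc, oneCocycleClass_zero,
      map_zero]
  haveI : Finite (continuousCohomology 1 ρ₁.toTopRep) := inferInstanceAs (Finite (discreteH1 Γ ↥(M[(n : ℤ)])))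
  let F : continuousCohomology 1 ρ₁.toTopRep → (discreteH1 Γ M)[(n : ℤ)] := fun y ↦
    ⟨cohomologyMap f 1 y, AddSubgroup.torsionBy.nsmul_iff.mpr (htor y)⟩
  have hF : Function.Surjective F := by
    rintro ⟨x, hx⟩
    obtain ⟨y, hy⟩ := hsurj x (AddSubgroup.torsionBy.nsmul_iff.mp hx)
    exact ⟨y, Subtype.ext hy⟩
  exact Finite.of_surjective F hF

end KummerFinite

section LocalFinite

variable (W : WeierstrassCurve K) [W.IsElliptic]

/-- **`{x ∈ H¹(Hi, E[p^∞]) : p x = 0}` is finite** in the local currency `Hi = Gal(K̄_v/K_{∞,w}) ≤ Γ_{K_v}` (any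
`ℤ_p`-extension, `v ∤ p` not split completely in `K_∞`, ANY reduction type of `E` at `v`): Kummer
(`finite_torsionBy_discreteH1_of_finite`) and the finiteness of `H¹(Hi, E[p])` (`NonsplitTower.finite_subgroupH1_and_natCard_le`,
`#E[p] = p²` prime to the residue characteristic). [cite: GreenbergLNM1716, §3 Lemma 3.3 (proof, p. 87)]
[cite: GreenbergVatsal2000, §2 Prop. (2.4)] -/
theorem finite_torsionBy_subgroupH1_localSubgroup_geomPrimaryTorsion {v : HeightOneSpectrum (𝓞 K)}
    (hpv : (p : 𝓞 K) ∉ v.asIdeal)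
    (hns : ∃ σ : absoluteGaloisGroup (v.adicCompletion K), σ ∉ localSubgroup κ.kerSubgroup (v.adicCompletion K)) :
    letI : DistribMulAction (absoluteGaloisGroup (v.adicCompletion K)) (W.geomPrimaryTorsion p) :=
      DistribMulAction.compHom _ (absGaloisRestrict K (v.adicCompletion K)).toMonoidHom
    Finite ((Literature.NumberTheory.EllipticCurves.subgroupH1
      (localSubgroup κ.kerSubgroup (v.adicCompletion K)) (W.geomPrimaryTorsion p))[(p : ℤ)]) := by
  set M := W.geomPrimaryTorsion p with hM
  letI inst : DistribMulAction (absoluteGaloisGroup (v.adicCompletion K)) M :=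
    DistribMulAction.compHom _ (absGaloisRestrict K (v.adicCompletion K)).toMonoidHom
  let Fv := v.adicCompletion K
  let G : Type := absoluteGaloisGroup Fv
  let Hi : Subgroup G := localSubgroup κ.kerSubgroup Fv
  let r : G →ₜ* absoluteGaloisGroup K := absGaloisRestrict K Fv
  let B : Type := ↥(M[(p : ℤ)])
  -- continuity of the orbit maps
  have hstab : ∀ m : M, IsOpen (MulAction.stabilizer (absoluteGaloisGroup K) m : Set (absoluteGaloisGroup K)) :=
    fun m ↦ X11b.LocBridge.isOpen_stabilizer_geomPrimaryTorsion W p m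
  have hcontK : ∀ m : M, Continuous fun σ : absoluteGaloisGroup K ↦ σ • m := fun m ↦
    continuous_smul_of_isOpen_stabilizer m (hstab m)
  have hcont : ∀ m : M, Continuous fun g : G ↦ g • m := fun m ↦ (hcontK m).comp r.continuous_toFun
  have hcontHi : ∀ m : M, Continuous fun g : Hi ↦ g • m := fun m ↦ (hcont m).comp continuous_subtype_val
  -- `H¹(Hi, E[p])` is finite
  haveI : Finite B := X2.LocalInertiaCohomologyMultiplicative.finite_torsionBy_curve W p
  have hBp : ∀ b : B, p • b = 0 := fun b ↦
    Subtype.ext (by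
      rw [AddSubgroupClass.coe_nsmul, ZeroMemClass.coe_zero]
      exact AddSubgroup.torsionBy.nsmul_iff.mp b.2)
  have hB : ∃ k : ℕ, ∀ b : B, p ^ k • b = 0 := ⟨1, fun b ↦ by rw [pow_one]; exact hBp b⟩
  have hcontB : ∀ b : B, Continuous fun g : G ↦ g • b := fun b ↦ (hcont (b : M)).subtype_mk _
  have hBcard : (Nat.card B).Coprime (ringChar 𝓀[Fv]) := by
    rw [show Nat.card B = p ^ 2 from X2.LocalInertiaCohomologyMultiplicative.natCard_torsionBy_curve W p]
    exact Nat.Coprime.pow_left 2 ((Nat.coprime_primes hp.out (ringChar_residueField_prime (F := Fv))).2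
      (Ne.symm (v.ringChar_residueField_adicCompletion_ne hpv)))
  obtain ⟨hfin, -⟩ := NonsplitTower.finite_subgroupH1_and_natCard_le κ hpv hns hB hBcard hcontB
  -- `H¹(Hi, B)` with `B` acted on through `Hi ≤ G`: this IS `discreteH1 Hi ↥(M[p])`
  haveI : Finite (discreteH1 Hi ↥(M[(p : ℤ)])) := hfin
  exact finite_torsionBy_discreteH1_of_finite (Γ := Hi) (M := M) p hcontHi
    (fun m ↦ X2.GreenbergVatsalTorsionCurve.divisible_curve W p m)

/-- **`H¹(ker κ ⊓ D_v, E[p^∞])[p]` is finite** (global currency; `v ∤ p` finitely decomposed in `K_∞`, any reduction type) —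
transport of `finite_torsionBy_subgroupH1_localSubgroup_geomPrimaryTorsion` along `H¹(ker κ ⊓ D_v, M) ≃+ H¹((ker κ)_v, M)`
(`CharLocalTameCorank.nonempty_addEquiv_subgroupH1_inf_decomp`). This is the finiteness that makes `zpCorank` additive over the
local factors. [cite: GreenbergLNM1716, §3 Lemma 3.3] [cite: GreenbergVatsal2000, §2 Cor. (2.3), Prop. (2.4)] -/
theorem finite_torsionBy_localH1_geomPrimaryTorsion {v : HeightOneSpectrum (𝓞 K)} (hpv : (p : 𝓞 K) ∉ v.asIdeal)
    (hD : ¬ (decomp v ≤ κ.kerSubgroup)) :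
    Finite ((Literature.NumberTheory.EllipticCurves.subgroupH1 (κ.kerSubgroup ⊓ decomp v)
      (W.geomPrimaryTorsion p))[(p : ℤ)]) := by
  letI inst : DistribMulAction (absoluteGaloisGroup (v.adicCompletion K)) (W.geomPrimaryTorsion p) :=
    DistribMulAction.compHom _ (absGaloisRestrict K (v.adicCompletion K)).toMonoidHom
  obtain ⟨e⟩ := CharLocalTameCorank.nonempty_addEquiv_subgroupH1_inf_decomp κ.kerSubgroup (W.geomPrimaryTorsion p) v
  haveI := finite_torsionBy_subgroupH1_localSubgroup_geomPrimaryTorsion κ W hpv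
    (CharLocalTameCorank.exists_not_mem_localSubgroup_of_not_decomp_le κ hD)
  exact Finite.of_equiv _ (torsionByEquiv e p).toEquiv.symm

end LocalFinite

/-! ## §3 The relaxation count from the surjectivity of the canonical localisation -/

section Count

variable (W : WeierstrassCurve K) [W.IsElliptic] (𝔭 : HeightOneSpectrum (𝓞 K)) (Sf : Finset (HeightOneSpectrum (𝓞 K)))

/-- **`corank_{ℤ_p}(Sel_𝔭^{Sf}/Sel_𝔭^∅) = Σ_{w∈Sf} [Γ:Γ_w] · corank_{ℤ_p} H¹(ker κ ⊓ D_w, E[p^∞])` granted a SURJECTION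
`Φ : Sel_𝔭^{Sf}(K_∞, E[p^∞]) ↠ ∏_{w∈Sf} ∏_{J w} H¹(ker κ ⊓ D_w, E[p^∞])`, `#J w = [Γ:Γ_w]`, with kernel `Sel_𝔭^∅`** (`Sf` finite,
`w ∤ p`, finitely decomposed in the `ℤ_p`-extension `κ`; any elliptic `W/K`, any `𝔭`). Additivity of `zpCorank` over the finite product
(each factor `p`-primary with finite `p`-torsion, §2). The algebra of Greenberg–Vatsal Cor. (2.3) for Castella's groups.
[cite: GreenbergVatsal2000, §2 Cor. (2.3), Prop. (2.4) (pp. 20–22)] [cite: PollackWeston2011, App. A Prop. A.2]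
[cite: KellerYin2024, Rem. 1.4.2 (arXiv:2402.12781v2 TeX L1130–1140)] -/
theorem zpCorank_selmerAc_quotient_eq_sum_of_surjective
    (hSfp : ∀ w ∈ Sf, ((p : ℕ) : 𝓞 K) ∉ w.asIdeal) (hSfdec : ∀ w ∈ Sf, ¬ (decomp w ≤ κ.kerSubgroup))
    {J : ↥Sf → Type} [∀ w, Fintype (J w)]
    (hJ : ∀ w : ↥Sf, Fintype.card (J w) = numPlacesAbove κ (w : HeightOneSpectrum (𝓞 K)))
    (Φ : ↥(X11b.AcSelmer.selmerAc W p κ 𝔭 (↑Sf : Set (HeightOneSpectrum (𝓞 K)))) →+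
      (∀ w : ↥Sf, J w →
        Literature.NumberTheory.EllipticCurves.subgroupH1
          (κ.kerSubgroup ⊓ decomp (w : HeightOneSpectrum (𝓞 K))) (W.geomPrimaryTorsion p)))
    (hΦ : Surjective Φ)
    (hker : Φ.ker = (X11b.AcSelmer.selmerAc W p κ 𝔭 (∅ : Set (HeightOneSpectrum (𝓞 K)))).addSubgroupOf
      (X11b.AcSelmer.selmerAc W p κ 𝔭 (↑Sf : Set (HeightOneSpectrum (𝓞 K))))) :
    zpCorank (↥(X11b.AcSelmer.selmerAc W p κ 𝔭 (↑Sf : Set (HeightOneSpectrum (𝓞 K)))) ⧸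
      (X11b.AcSelmer.selmerAc W p κ 𝔭 (∅ : Set (HeightOneSpectrum (𝓞 K)))).addSubgroupOf
        (X11b.AcSelmer.selmerAc W p κ 𝔭 (↑Sf : Set (HeightOneSpectrum (𝓞 K))))) p =
      ∑ w ∈ Sf, numPlacesAbove κ w *
        zpCorank (Literature.NumberTheory.EllipticCurves.subgroupH1 (κ.kerSubgroup ⊓ decomp w)
          (W.geomPrimaryTorsion p)) p := by
  have htor : ∀ m : W.geomPrimaryTorsion p, ∃ k : ℕ, p ^ k • m = 0 :=
    X2.LocalInertiaCohomologyMultiplicative.primary_curve W p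
  have hfin : ∀ (w : ↥Sf) (_ : J w),
      Finite ((Literature.NumberTheory.EllipticCurves.subgroupH1
        (κ.kerSubgroup ⊓ decomp (w : HeightOneSpectrum (𝓞 K))) (W.geomPrimaryTorsion p))[(p : ℤ)]) := fun w _ ↦
    finite_torsionBy_localH1_geomPrimaryTorsion κ W (hSfp w w.2) (hSfdec w w.2)
  rw [zpCorank_quotient_eq_sum_sum_of_surjective (hfin := hfin) _ _ Φ hΦ hker
    (fun w _ x ↦ exists_pow_smul_localH1_eq_zero κ htor (w : HeightOneSpectrum (𝓞 K)) x)]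
  rw [← Finset.sum_coe_sort Sf]
  refine Finset.sum_congr rfl fun w _ ↦ ?_
  rw [Finset.sum_const, Finset.card_univ, hJ w, smul_eq_mul]

/-- **The count from the SURJECTIVITY OF THE CANONICAL LOCALISATION** `c ↦ (res_{ker κ ⊓ D_w} conj_{γ^i} c)_{w∈Sf, i<N w}`
(`N w = [Γ:Γ_w] = numPlacesAbove κ w`, `γ` a topological generator): its kernel is `Sel_𝔭^∅` (§1).
[cite: GreenbergVatsal2000, §2 Cor. (2.3)] [cite: KellerYin2024, Prop. 1.2.5 (eq:Gr to imp) (arXiv:2402.12781v2 TeX L789–800)] -/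
theorem zpCorank_selmerAc_quotient_eq_sum_of_pi_surjective {γ : absoluteGaloisGroup K} (hγ : κ.IsTopGenerator γ)
    (hSfp : ∀ w ∈ Sf, ((p : ℕ) : 𝓞 K) ∉ w.asIdeal) (hSfdec : ∀ w ∈ Sf, ∃ δ ∈ decomp (K := K) w, κ δ ≠ 1)
    (N : HeightOneSpectrum (𝓞 K) → ℕ) (hN : ∀ w ∈ Sf, N w = numPlacesAbove κ w)
    (hsurj : Surjective ((AddMonoidHom.pi fun w : ↥Sf ↦
        AddMonoidHom.pi fun i : Fin (N (w : HeightOneSpectrum (𝓞 K))) ↦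
          (resOfLe (W.geomPrimaryTorsion p) (inf_le_left :
              κ.kerSubgroup ⊓ decomp (K := K) (w : HeightOneSpectrum (𝓞 K)) ≤ κ.kerSubgroup)).comp
            (conjH1 κ.kerSubgroup (W.geomPrimaryTorsion p) (γ ^ (i : ℕ)))).comp
        (X11b.AcSelmer.selmerAc W p κ 𝔭 (↑Sf : Set (HeightOneSpectrum (𝓞 K)))).subtype)) :
    zpCorank (↥(X11b.AcSelmer.selmerAc W p κ 𝔭 (↑Sf : Set (HeightOneSpectrum (𝓞 K)))) ⧸
      (X11b.AcSelmer.selmerAc W p κ 𝔭 (∅ : Set (HeightOneSpectrum (𝓞 K)))).addSubgroupOf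
        (X11b.AcSelmer.selmerAc W p κ 𝔭 (↑Sf : Set (HeightOneSpectrum (𝓞 K))))) p =
      ∑ w ∈ Sf, numPlacesAbove κ w *
        zpCorank (Literature.NumberTheory.EllipticCurves.subgroupH1 (κ.kerSubgroup ⊓ decomp w)
          (W.geomPrimaryTorsion p)) p := by
  have hSfdec' : ∀ w ∈ Sf, ¬ (decomp w ≤ κ.kerSubgroup) := fun w hw hle ↦ by
    obtain ⟨δ, hδ, hne⟩ := hSfdec w hw
    exact hne (ZpExtension.mem_kerSubgroup.mp (hle hδ))
  exact zpCorank_selmerAc_quotient_eq_sum_of_surjective κ W 𝔭 Sf hSfp hSfdec'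
    (J := fun w ↦ Fin (N (w : HeightOneSpectrum (𝓞 K))))
    (fun w ↦ by rw [Fintype.card_fin, hN w w.2]) _ hsurj
    (ker_pi_resOfLe_conjH1_selmerAc_eq κ W 𝔭 Sf hγ hSfp hSfdec N hN)

/-- **The count from the `∃`-FORM surjectivity with ARBITRARY representatives** — exactly the shape the cell `bsd-eis` engine
`AcTwistDeformation.exists_mem_unramifiedOutside_forall_resOfLe_conjH1_eq_of_SUR` delivers: exponents `a_w` with
`κ(D_w) = p^{a_w} ℤ_p` exactly (`hdiv`, `hd₀`), representatives `σrep w i` with `κ(σrep w i) = i` (`i < p^{a_w}`), and for EVERY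
family of local targets a class of `Sel_𝔭^{Sf}` hitting it. Then
`corank_{ℤ_p}(Sel_𝔭^{Sf}/Sel_𝔭^∅) = Σ_{w∈Sf} [Γ:Γ_w] · corank_{ℤ_p} H¹(ker κ ⊓ D_w, E[p^∞])`.
[cite: GreenbergVatsal2000, §2 Cor. (2.3), Prop. (2.4)] [cite: PollackWeston2011, App. A Prop. A.2] -/
theorem zpCorank_selmerAc_quotient_eq_sum_of_forall_exists {γ : absoluteGaloisGroup K} (hγ : κ.IsTopGenerator γ)
    (hSfp : ∀ w ∈ Sf, ((p : ℕ) : 𝓞 K) ∉ w.asIdeal) (hSfdec : ∀ w ∈ Sf, ∃ δ ∈ decomp (K := K) w, κ δ ≠ 1)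
    (a : HeightOneSpectrum (𝓞 K) → ℕ)
    (hdiv : ∀ w ∈ Sf, ∀ δ ∈ decomp (K := K) w, (p : ℤ_[p]) ^ a w ∣ (κ δ).toAdd)
    (hd₀ : ∀ w ∈ Sf, ∃ δ ∈ decomp (K := K) w, (κ δ).toAdd = (p : ℤ_[p]) ^ a w)
    (σrep : HeightOneSpectrum (𝓞 K) → ℕ → absoluteGaloisGroup K)
    (hσrep : ∀ w ∈ Sf, ∀ i : ℕ, i < p ^ a w → (κ (σrep w i)).toAdd = (i : ℤ_[p]))
    (hsurj : ∀ y : (w : HeightOneSpectrum (𝓞 K)) → ℕ →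
        Literature.NumberTheory.EllipticCurves.subgroupH1 (κ.kerSubgroup ⊓ decomp (K := K) w) (W.geomPrimaryTorsion p),
      ∃ u ∈ X11b.AcSelmer.selmerAc W p κ 𝔭 (↑Sf : Set (HeightOneSpectrum (𝓞 K))),
        ∀ w ∈ Sf, ∀ i : ℕ, i < p ^ a w →
          resOfLe (W.geomPrimaryTorsion p) (inf_le_left : κ.kerSubgroup ⊓ decomp (K := K) w ≤ κ.kerSubgroup)
            (conjH1 κ.kerSubgroup (W.geomPrimaryTorsion p) (σrep w i) u) = y w i) :
    zpCorank (↥(X11b.AcSelmer.selmerAc W p κ 𝔭 (↑Sf : Set (HeightOneSpectrum (𝓞 K)))) ⧸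
      (X11b.AcSelmer.selmerAc W p κ 𝔭 (∅ : Set (HeightOneSpectrum (𝓞 K)))).addSubgroupOf
        (X11b.AcSelmer.selmerAc W p κ 𝔭 (↑Sf : Set (HeightOneSpectrum (𝓞 K))))) p =
      ∑ w ∈ Sf, numPlacesAbove κ w *
        zpCorank (Literature.NumberTheory.EllipticCurves.subgroupH1 (κ.kerSubgroup ⊓ decomp w)
          (W.geomPrimaryTorsion p)) p := by
  have hN : ∀ w ∈ Sf, p ^ a w = numPlacesAbove κ w := fun w hw ↦
    (numPlacesAbove_eq_pow_of_forall_dvd κ w (hdiv w hw) (hd₀ w hw)).symm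
  refine zpCorank_selmerAc_quotient_eq_sum_of_pi_surjective κ W 𝔭 Sf hγ hSfp hSfdec (fun w ↦ p ^ a w) hN ?_
  refine surjective_pi_of_forall_exists (X11b.AcSelmer.selmerAc W p κ 𝔭 (↑Sf : Set (HeightOneSpectrum (𝓞 K))))
    Sf (fun w ↦ p ^ a w) (fun w i ↦ (resOfLe (W.geomPrimaryTorsion p) (inf_le_left :
      κ.kerSubgroup ⊓ decomp (K := K) w ≤ κ.kerSubgroup)).comp (conjH1 κ.kerSubgroup (W.geomPrimaryTorsion p) (γ ^ i)))
    fun y ↦ ?_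
  obtain ⟨u, hu, h⟩ := hsurj y
  refine ⟨u, hu, fun w hw i hi ↦ ?_⟩
  have hκ : κ (γ ^ i) = κ (σrep w i) :=
    Multiplicative.toAdd.injective (by rw [toAdd_apply_pow_of_isTopGenerator κ hγ i, hσrep w hw i hi])
  rw [AddMonoidHom.comp_apply, conjH1_eq_of_apply_eq κ hκ]
  exact h w hw i hi

end Count

end Summit.BirchSwinnertonDyer.BirchSwinnertonDyer.Theorems.CurveRelaxationCount

end
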